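import Summits.QuantumAdvantage.QuantumAdvantage.Theorems.NearExactIsExact.Negative.NoCaseATwelve
import HarnessLib

/-!
# Type-O cubics on 12 bits: the third 2-adic digit has degree EXACTLY 3 (NearExactIsExact, disprover gen 23)

Negative-side STRUCTURE for the crux `CubicForrelation.NearExactIsExact` (item `near_exact_is_exact`,
stmt-QuantumAdvantage-14043), B2b disprover seat gen 23. HONEST FRAMING: a THEOREM about the finite slice `n = 12`,
NOT summit progress.

For a cubic `g : 𝔽₂¹² → 𝔽₂` with `W_g = 16·u` and every `u(x)` odd (type O) write `u = 2u₁ + 1`, `u₁ = 2u₂ + t`,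
`t = [u₁ odd]`. The tree knows: `[u₁ odd]` is AFFINE (`digit_two`) and `[u₂ odd]` is CUBIC (`digit_three`); `no_caseA`
is the statement that `[u₂ odd] = ¬[u₁ odd]` is impossible. This file proves the common generalisation behind `no_caseA`:

* `digit_three_not_quadratic`: `[u₂ odd]` is NOT of degree `≤ 2` — so by `digit_three` it has degree exactly `3`;
* `digit_three_not_affine`: in particular it is not affine (`no_caseA` is the special case `[u₂ odd] = 1 ⊕ [u₁ odd]`).

Proof (the `no_caseA` mechanism). (1) `u(0…0)` odd and `cube_bias_congr` (`m = 4`) make the number `N₄` of `4`-sets of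
cubic monomials tiling the `12` variables odd; (2) by `card_saturated_four` some cubic monomial `s₀ ∋ 0` with support `T`
(`|T| = 3`) has `N₃(Tᶜ)` odd, and Poisson (`bb_poisson`) over `E_T` with `cube_bias_congr` (`m = 3`) on `E_{Tᶜ}` gives
`Σ_{x ∈ E_T} u(x) ≡ 4 (mod 8)`; (3) pointwise `u = 8q + 4s + 2t + 1` with `s = [u₂ odd]`, and on the `3`-cube `E_T` the
affine `t` has `Σ t ∈ {0,4,8}` (Ax, `d = 1`) while a degree-`≤ 2` function `s` has `Σ s` even (Ax, `d = 2`: `RM(2,3)` is the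
even-weight code), so `Σ_{E_T} u ≡ 8 + 2·{0,4,8} + 4·even ≡ 0 (mod 8)` — contradiction.

Use (gen-23 paper theorem CA-W, DISPROOF.md §30 of the B2b folder): slicing a case-A type-O cubic on `14` bits over the
two coordinates of its rank-`2` digit quadratic produces four type-O cubics on `12` bits whose third digit is a
translate of one common function `μ`; a cubic partner with `Φ > 59/64` forces `μ` affine, which this file forbids.
Numerics (code/disprove-g23/d3na12.c): 21 424 random type-O cubics on 12 bits, third digit of degree exactly 3 in all.

Sources: J. Ax (1964) / R. McEliece (1972) [Carlet2020 §4.1]; MacWilliams–Sloane Ch. 13–15. Axioms: the standard three.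
-/

set_option linter.dupNamespace false -- D-0017: single-problem summit ⇒ `QuantumAdvantage.QuantumAdvantage` by design

noncomputable section

namespace Summit.QuantumAdvantage.QuantumAdvantage.Theorems.NearExactIsExact.Negative.TypeOTwelve

open Finset
open Literature.Computability.QuantumComplexity
open Literature.Computability.QuantumComplexity.DerivativeWalsh (W)
open Summit.QuantumAdvantage.QuantumAdvantage.Theorems.CubicForrelation.NearExactIsExact

section DigitThreeDegree

variable (g : (Fin (6 + 6) → Bool) → Bool) (u : (Fin (6 + 6) → Bool) → ℤ)

/-- **The third digit of a type-O cubic on 12 bits is not quadratic.** For cubic `g : 𝔽₂¹² → 𝔽₂` with `W_g = 16u`,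
`u = 2u₁ + 1` (all `u` odd), `u₁ = 2u₂ + t`, `t = [u₁ odd]`: the Boolean function `x ↦ [u₂(x) odd]` does NOT have
algebraic degree `≤ 2` (with `digit_three`: its degree is exactly `3`). NOT summit progress. [this work] -/
theorem digit_three_not_quadratic (hg : IsDegLeFun 3 g)
    (hu : ∀ x, W (fun y => signOf (g y)) x = (2 : ℝ) ^ 4 * (u x : ℝ))
    (u₁ u₂ t : (Fin (6 + 6) → Bool) → ℤ) (h1 : ∀ x, u x = 2 * u₁ x + 1) (h2 : ∀ x, u₁ x = 2 * u₂ x + t x)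
    (ht : ∀ x, t x = if Odd (u₁ x) then 1 else 0)
    (hq : IsDegLeFun 2 (fun x => decide (Odd (u₂ x)))) : False := by
  obtain ⟨p, hp, hrep⟩ := id hg
  -- the integer bias sums over coordinate cubes
  have hbias : ∀ K : Finset (Fin (6 + 6)),
      ∑ x ∈ {x : Fin (6 + 6) → Bool | ∀ i, x i = true → i ∈ K}, signOf (g x) =
        ((∑ x ∈ {x : Fin (6 + 6) → Bool | ∀ i, x i = true → i ∈ K},
          ∏ s ∈ p.support, (if (∀ j ∈ s.support, x j = true) then (-1 : ℤ) else 1) : ℤ) : ℝ) := by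
    intro K
    rw [Int.cast_sum]
    exact sum_congr rfl fun x _ => by rw [hrep x, ax_signOf_polyPhase]
  -- Poisson summation: `16 Σ_{E_I} u = 2^{|I|} Σ_{E_{Iᶜ}} (−1)^g`
  have hpois : ∀ I : Finset (Fin (6 + 6)),
      (2 : ℝ) ^ 4 * ∑ x ∈ {x : Fin (6 + 6) → Bool | ∀ i, x i = true → i ∈ I}, (u x : ℝ) =
        (2 : ℝ) ^ #I * ∑ y ∈ {x : Fin (6 + 6) → Bool | ∀ i, x i = true → i ∈ Iᶜ}, signOf (g y) := by
    intro I
    have hP := bb_poisson (fun y => signOf (g y)) I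
    rw [sum_congr rfl fun x _ => hu x, ← mul_sum] at hP
    exact hP
  -- (1) `N₄` is odd
  obtain ⟨k₄, hk₄⟩ := cube_bias_congr p hp univ 4 (by rw [card_univ, Fintype.card_fin])
  have hE0 : #({x : Fin (6 + 6) → Bool | ∀ i, x i = true → i ∈ (∅ : Finset (Fin (6 + 6)))} : Finset _) = 1 := by
    rw [bb_card_cube, card_empty, pow_zero]
  obtain ⟨a, ha⟩ := card_eq_one.1 hE0
  have h0 := hpois ∅
  rw [ha, sum_singleton, card_empty, pow_zero, one_mul, compl_empty, hbias univ, hk₄] at h0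
  have h0z : (2 : ℤ) ^ 4 * u a = (-2) ^ 4 *
      (#{S ∈ p.support.powerset | #S = 4 ∧ (S.biUnion fun s => s.support) = univ} : ℕ) + 2 ^ (4 + 1) * k₄ := by
    exact_mod_cast h0
  have hN₄ : ¬ Even #{S ∈ p.support.powerset | #S = 4 ∧ (S.biUnion fun s => s.support) = univ} := by
    rintro ⟨r, hr⟩
    have hua := h1 a
    rw [hr] at h0z
    push_cast at h0z
    omega
  -- (2) some monomial `s₀ ∋ 0` has an odd number of `3`-sets tiling the complement of its support `T`
  rw [card_saturated_four p hp] at hN₄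
  have hex : ∃ s₀ : Fin (6 + 6) →₀ ℕ,
      s₀ ∈ p.support.filter (fun s => (0 : Fin (6 + 6)) ∈ s.support) ∧
      ¬ Even #{S' ∈ p.support.powerset | #S' = 3 ∧ (S'.biUnion fun s => s.support) = s₀.supportᶜ} := by
    by_contra hall
    push Not at hall
    exact hN₄ (Finset.even_sum _ hall)
  obtain ⟨s₀, hs₀F, hs₀odd⟩ := hex
  set T := s₀.support with hT
  have hT3 : #T = 3 := by
    have hle : #T ≤ 3 := ax_card_support_le hp (mem_filter.1 hs₀F).1
    have hne : ({S' ∈ p.support.powerset | #S' = 3 ∧ (S'.biUnion fun s => s.support) = Tᶜ} : Finset _).Nonempty := by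
      rw [nonempty_iff_ne_empty]
      intro h
      rw [h, card_empty] at hs₀odd
      exact hs₀odd ⟨0, rfl⟩
    obtain ⟨S', hS'⟩ := hne
    obtain ⟨hS'p, hS'3, hS'U⟩ := mem_filter.1 hS'
    have h9 : #(S'.biUnion fun s => s.support) ≤ 3 * #S' := ax_card_biUnion_le hp (mem_powerset.1 hS'p)
    rw [hS'U, hS'3, card_compl, Fintype.card_fin] at h9
    omega
  obtain ⟨k₃, hk₃⟩ := cube_bias_congr p hp Tᶜ 3 (by rw [card_compl, Fintype.card_fin, hT3])
  have h1T := hpois T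
  rw [hT3, hbias Tᶜ, hk₃] at h1T
  have h1z : (2 : ℤ) ^ 4 * ∑ x ∈ {x : Fin (6 + 6) → Bool | ∀ i, x i = true → i ∈ T}, u x =
      2 ^ 3 * ((-2) ^ 3 *
        (#{S' ∈ p.support.powerset | #S' = 3 ∧ (S'.biUnion fun s => s.support) = Tᶜ} : ℕ) + 2 ^ (3 + 1) * k₃) := by
    exact_mod_cast h1T
  obtain ⟨j, hj⟩ := Nat.not_even_iff_odd.1 hs₀odd
  rw [hj] at h1z
  push_cast at h1z
  -- (3a) the affine second digit on the cube `E_T`: `Σ_{E_T} t = 4 − 4z`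
  have hτ := digit_two g u hg hu u₁ h1
  obtain ⟨z, hz⟩ := stub_axParity (6 + 6) 1 (fun x => decide (Odd (u₁ x))) T le_rfl hτ
  have hexp : (#T + 1 - 1) / 1 = 3 := by rw [hT3]
  rw [hexp] at hz
  have hsign : ∀ x, signOf (decide (Odd (u₁ x))) = 1 - 2 * (t x : ℝ) := fun x => by
    rw [ht x]
    by_cases h : Odd (u₁ x)
    · simp [h, signOf]; norm_num
    · simp [h, signOf]
  rw [sum_congr rfl fun x _ => hsign x, sum_sub_distrib, sum_const, nsmul_eq_mul, mul_one, ← mul_sum] at hz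
  have hcardR : ((#({x : Fin (6 + 6) → Bool | ∀ i, x i = true → i ∈ T} : Finset _) : ℕ) : ℝ) = (2 : ℝ) ^ 3 := by
    rw [bb_card_cube T, hT3]
    norm_num
  rw [hcardR] at hz
  have hTz : (2 : ℤ) ^ 3 - 2 * ∑ x ∈ {x : Fin (6 + 6) → Bool | ∀ i, x i = true → i ∈ T}, t x = 2 ^ 3 * z := by
    exact_mod_cast hz
  -- (3b) the quadratic third digit on the cube `E_T`: `Σ_{E_T} s` is even
  obtain ⟨sd, hsd⟩ : ∃ sd : (Fin (6 + 6) → Bool) → ℤ, ∀ x, sd x = if Odd (u₂ x) then 1 else 0 := ⟨_, fun _ => rfl⟩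
  obtain ⟨z', hz'⟩ := stub_axParity (6 + 6) 2 (fun x => decide (Odd (u₂ x))) T (by norm_num) hq
  have hexp' : (#T + 2 - 1) / 2 = 2 := by rw [hT3]
  rw [hexp'] at hz'
  have hsign' : ∀ x, signOf (decide (Odd (u₂ x))) = 1 - 2 * (sd x : ℝ) := fun x => by
    rw [hsd x]
    by_cases h : Odd (u₂ x)
    · simp [h, signOf]; norm_num
    · simp [h, signOf]
  rw [sum_congr rfl fun x _ => hsign' x, sum_sub_distrib, sum_const, nsmul_eq_mul, mul_one, ← mul_sum, hcardR] at hz'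
  have hSz : (2 : ℤ) ^ 3 - 2 * ∑ x ∈ {x : Fin (6 + 6) → Bool | ∀ i, x i = true → i ∈ T}, sd x = 2 ^ 2 * z' := by
    exact_mod_cast hz'
  -- pointwise `u = 8q + 4 sd + 2 t + 1` with `q = u₂ / 2`
  have hpt : ∀ x, u x = 8 * (u₂ x / 2) + 4 * sd x + 2 * t x + 1 := by
    intro x
    rw [h1 x, h2 x, hsd x]
    by_cases ho : Odd (u₂ x)
    · rw [if_pos ho]
      have h2' := Int.odd_iff.1 ho
      omega
    · rw [if_neg ho]
      have h2' := Int.even_iff.1 (Int.not_odd_iff_even.1 ho)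
      omega
  have hsumT : ∑ x ∈ {x : Fin (6 + 6) → Bool | ∀ i, x i = true → i ∈ T}, u x =
      8 * ∑ x ∈ {x : Fin (6 + 6) → Bool | ∀ i, x i = true → i ∈ T}, (u₂ x / 2) +
        4 * ∑ x ∈ {x : Fin (6 + 6) → Bool | ∀ i, x i = true → i ∈ T}, sd x +
        2 * ∑ x ∈ {x : Fin (6 + 6) → Bool | ∀ i, x i = true → i ∈ T}, t x + 2 ^ #T := by
    rw [sum_congr rfl fun x _ => hpt x, sum_add_distrib, sum_add_distrib, sum_add_distrib, ← mul_sum, ← mul_sum,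
      ← mul_sum, sum_const, nsmul_eq_mul, mul_one, card_cube_int]
  rw [hT3] at hsumT
  have e1 : ∑ x ∈ {x : Fin (6 + 6) → Bool | ∀ i, x i = true → i ∈ T}, u x = -8 * (j : ℤ) - 4 + 8 * k₃ := by
    linarith [h1z]
  have e2 : ∑ x ∈ {x : Fin (6 + 6) → Bool | ∀ i, x i = true → i ∈ T}, t x = 4 - 4 * z := by
    linarith [hTz]
  have e2' : ∑ x ∈ {x : Fin (6 + 6) → Bool | ∀ i, x i = true → i ∈ T}, sd x = 4 - 2 * z' := by
    linarith [hSz]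
  generalize ∑ x ∈ {x : Fin (6 + 6) → Bool | ∀ i, x i = true → i ∈ T}, u x = A at e1 hsumT
  generalize ∑ x ∈ {x : Fin (6 + 6) → Bool | ∀ i, x i = true → i ∈ T}, (u₂ x / 2) = Q at hsumT
  generalize ∑ x ∈ {x : Fin (6 + 6) → Bool | ∀ i, x i = true → i ∈ T}, t x = B at e2 hsumT
  generalize ∑ x ∈ {x : Fin (6 + 6) → Bool | ∀ i, x i = true → i ∈ T}, sd x = C at e2' hsumT
  omega

/-- **The third digit of a type-O cubic on 12 bits is not affine** (the form used by the n = 14 slicing argument;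
`no_caseA` is the instance `[u₂ odd] = 1 ⊕ [u₁ odd]`). NOT summit progress. [this work] -/
theorem digit_three_not_affine (hg : IsDegLeFun 3 g)
    (hu : ∀ x, W (fun y => signOf (g y)) x = (2 : ℝ) ^ 4 * (u x : ℝ))
    (u₁ u₂ t : (Fin (6 + 6) → Bool) → ℤ) (h1 : ∀ x, u x = 2 * u₁ x + 1) (h2 : ∀ x, u₁ x = 2 * u₂ x + t x)
    (ht : ∀ x, t x = if Odd (u₁ x) then 1 else 0)
    (ha : IsDegLeFun 1 (fun x => decide (Odd (u₂ x)))) : False :=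
  digit_three_not_quadratic g u hg hu u₁ u₂ t h1 h2 ht (ha.mono (by norm_num))

/-- **Degree exactly 3**, packaged: under the hypotheses of `digit_three`, the third digit has degree `≤ 3` and
not `≤ 2`. NOT summit progress. [this work] -/
theorem digit_three_degree_eq (hg : IsDegLeFun 3 g)
    (hu : ∀ x, W (fun y => signOf (g y)) x = (2 : ℝ) ^ 4 * (u x : ℝ))
    (u₁ u₂ t : (Fin (6 + 6) → Bool) → ℤ) (h1 : ∀ x, u x = 2 * u₁ x + 1) (h2 : ∀ x, u₁ x = 2 * u₂ x + t x)
    (ht : ∀ x, t x = if Odd (u₁ x) then 1 else 0) :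
    IsDegLeFun 3 (fun x => decide (Odd (u₂ x))) ∧ ¬ IsDegLeFun 2 (fun x => decide (Odd (u₂ x))) :=
  ⟨digit_three g u hg hu u₁ u₂ t h1 h2 ht, fun hq => digit_three_not_quadratic g u hg hu u₁ u₂ t h1 h2 ht hq⟩

end DigitThreeDegree

end Summit.QuantumAdvantage.QuantumAdvantage.Theorems.NearExactIsExact.Negative.TypeOTwelve
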